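import Literature.Probability.RandomPlanarGeometry.RestrictionSides
import Literature.Probability.RandomPlanarGeometry.HalfPlaneFill

/-!
# Avoidance determines the law (stmt-CriticalPhenomena-1373): a connectivity lemma

Landing target:
`Summits/CriticalPhenomena/SAWScalingLimit/Theorems/SAWLoopFugacityFlowAvoidanceDeterminesLawConn.lean`
(`--supports stmt-CriticalPhenomena-1373`).

Half-plane topology for the two-sided step of the proof of `AvoidanceDeterminesLaw`: if a closed
bounded `X` lies to the right and a closed bounded `Y` to the left of a configuration `K` of
[LSW]'s space `Ω` (a simple path from `0` to `∞` in our application), and `ℍ ∖ X`, `ℍ ∖ Y` are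
connected, then `ℍ ∖ (X ∪ Y)` is connected: a bounded complementary component would have
boundary points on both `X` and `Y`, hence its (connected) closure would meet both the right
and the left domain of `K` while missing the mirror closure of `K` — impossible, the two domains
being disjoint (the crossing lemma of `RestrictionSides`).
-/

noncomputable section

open scoped Topology
open Filter Set Metric Bornology
open Literature.Probability.RandomPlanarGeometry
open UpperHalfPlane (upperHalfPlaneSet isOpen_upperHalfPlaneSet)

namespace Summit.CriticalPhenomena.SAWScalingLimit.Theorems.AvoidanceDeterminesLaw

/-- A connected component of an open set `U ⊆ ℂ` is relatively closed in `U`: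
`closure P ∩ U ⊆ P`. [folklore] -/
theorem closure_connectedComponentIn_inter_subset {U : Set ℂ} (z : ℂ) :
    closure (connectedComponentIn U z) ∩ U ⊆ connectedComponentIn U z := by
  by_cases hz : z ∈ U
  · intro w hw
    have hpre : IsPreconnected (closure (connectedComponentIn U z) ∩ U) :=
      isPreconnected_connectedComponentIn.subset_closure
        (subset_inter subset_closure (connectedComponentIn_subset U z)) inter_subset_left
    exact hpre.subset_connectedComponentIn (mem_connectedComponentIn hz |> fun h ↦
      ⟨subset_closure h, hz⟩) inter_subset_right hw
  · rw [connectedComponentIn_eq_empty hz]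
    simp

/-- If `P` is a component of the open set `U`, a point of `frontier P` is not in `U`. [folklore] -/
theorem notMem_of_mem_frontier_connectedComponentIn {U : Set ℂ} (hU : IsOpen U) {z w : ℂ}
    (hw : w ∈ frontier (connectedComponentIn U z)) : w ∉ U := fun hwU ↦ by
  have hwP : w ∈ connectedComponentIn U z :=
    closure_connectedComponentIn_inter_subset z ⟨frontier_subset_closure hw, hwU⟩
  exact hw.2 (interior_maximal Subset.rfl hU.connectedComponentIn hwP)

/-- **A bounded complementary component must touch the obstacle it is glued to.** Let `U = ℍ ∖ S`
with `S` closed and `P` a bounded component of `U`. If `ℍ ∖ X` is connected and unbounded,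
`X ⊆ S`, and every frontier point of `P` in `ℍ` off `X` is impossible (i.e. `frontier P ∩ ℍ ⊆ X`),
then we get a contradiction: `P` would be clopen in `ℍ ∖ X`. Stated positively: some frontier
point of `P` lies in `ℍ ∖ X` (necessarily in `S`). [folklore] -/
theorem exists_mem_frontier_diff {S X : Set ℂ} (hXS : X ⊆ S) (hXconn : IsPreconnected (upperHalfPlaneSet \ X))
    (hXub : ¬ IsBounded (upperHalfPlaneSet \ X)) {z : ℂ} (hz : z ∈ upperHalfPlaneSet \ S)
    (hPb : IsBounded (connectedComponentIn (upperHalfPlaneSet \ S) z)) (hS : IsClosed S) :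
    ∃ w ∈ frontier (connectedComponentIn (upperHalfPlaneSet \ S) z), w ∈ upperHalfPlaneSet ∧ w ∉ X := by
  set U := upperHalfPlaneSet \ S with hUdef
  set P := connectedComponentIn U z with hPdef
  have hUo : IsOpen U := isOpen_upperHalfPlaneSet.sdiff hS
  have hPo : IsOpen P := hUo.connectedComponentIn
  by_contra h
  push Not at h
  -- `P` is relatively closed in `ℍ ∖ X`
  have hcl : closure P ∩ (upperHalfPlaneSet \ X) ⊆ P := by
    rintro w ⟨hwcl, hwH, hwX⟩
    by_cases hwP : w ∈ P
    · exact hwP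
    · have hwfr : w ∈ frontier P := by
        rw [frontier_eq_closure_inter_closure]
        exact ⟨hwcl, subset_closure hwP⟩
      exact absurd (h w hwfr hwH) hwX
  have hPsub : P ⊆ upperHalfPlaneSet \ X := fun w hw ↦
    ⟨(connectedComponentIn_subset U z hw).1, fun hwX ↦ (connectedComponentIn_subset U z hw).2 (hXS hwX)⟩
  have hne : ((upperHalfPlaneSet \ X) ∩ P).Nonempty := ⟨z, hPsub (mem_connectedComponentIn hz),
    mem_connectedComponentIn hz⟩
  have hall : upperHalfPlaneSet \ X ⊆ P :=
    hXconn.subset_of_closure_inter_subset hPo hne (fun w hw ↦ hcl ⟨hw.1, hw.2⟩)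
  exact hXub (hPb.subset hall)

/-- **Connectivity of `ℍ` minus a right obstacle and a left obstacle.** Let `K ∈ Ω` be a
restriction configuration, `X` a closed bounded set inside the right domain of `K` and `Y` a
closed bounded set inside its left domain, with `ℍ ∖ X` and `ℍ ∖ Y` connected. Then
`ℍ ∖ (X ∪ Y)` is connected. [folklore] -/
theorem isConnected_diff_union_of_sides (K : RestrictionConfig) {X Y : Set ℂ} (hXc : IsClosed X)
    (hYc : IsClosed Y) (hXb : IsBounded X) (hYb : IsBounded Y) (hX : X ⊆ K.rightDomain)
    (hY : Y ⊆ K.leftDomain) (hXconn : IsConnected (upperHalfPlaneSet \ X))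
    (hYconn : IsConnected (upperHalfPlaneSet \ Y)) :
    IsConnected (upperHalfPlaneSet \ (X ∪ Y)) := by
  classical
  set S := X ∪ Y with hSdef
  have hSc : IsClosed S := hXc.union hYc
  have hSb : IsBounded S := hXb.union hYb
  set U := upperHalfPlaneSet \ S with hUdef
  set V := Loewner.unboundedComponent U with hVdef
  have hUo : IsOpen U := isOpen_upperHalfPlaneSet.sdiff hSc
  obtain ⟨R, hR⟩ := hSb.subset_closedBall 0
  -- far points exist, so `ℍ ∖ X`, `ℍ ∖ Y`, `U` are unbounded
  have hfar : ∀ T : Set ℂ, T ⊆ closedBall (0 : ℂ) R → ¬ IsBounded (upperHalfPlaneSet \ T) := by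
    intro T hT hb
    obtain ⟨R', hR'⟩ := hb.subset_closedBall 0
    obtain ⟨h1, h2⟩ := farPoint_mem (max R R')
    have hmem : ((|max R R'| + 1 : ℝ) : ℂ) * Complex.I ∈ upperHalfPlaneSet \ T :=
      ⟨h1, fun hT' ↦ by
        have := hT hT'
        rw [mem_closedBall, dist_zero_right] at this
        linarith [le_max_left R R']⟩
    have := hR' hmem
    rw [mem_closedBall, dist_zero_right] at this
    linarith [le_max_right R R']
  -- `K ⊆ U`: `K` misses `X` and `Y`
  have hKmir : (K : Set ℂ) ⊆ K.mirrorClosure := fun w hw ↦ K.closure_subset_mirrorClosure (subset_closure hw)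
  have hKX : Disjoint (K : Set ℂ) X := Set.disjoint_left.2 fun w hwK hwX ↦
    K.rightDomain_subset_compl (hX hwX) (hKmir hwK)
  have hKY : Disjoint (K : Set ℂ) Y := Set.disjoint_left.2 fun w hwK hwY ↦
    K.leftDomain_subset_compl (hY hwY) (hKmir hwK)
  have hKU : (K : Set ℂ) ⊆ U := fun w hw ↦ ⟨K.subset_upperHalfPlaneSet hw, fun hwS ↦ hwS.elim
    (fun h ↦ Set.disjoint_left.1 hKX hw h) (fun h ↦ Set.disjoint_left.1 hKY hw h)⟩
  have hKV : (K : Set ℂ) ⊆ V :=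
    subset_unboundedComponent_of_isPreconnected K.isConnected.isPreconnected hKU K.not_isBounded
  -- `0 ∉ S`
  have h0X : (0 : ℂ) ∉ X := fun h ↦ K.ofReal_notMem_rightDomain le_rfl (by simpa using hX h)
  have h0Y : (0 : ℂ) ∉ Y := fun h ↦ K.ofReal_notMem_leftDomain le_rfl (by simpa using hY h)
  have h0S : (0 : ℂ) ∉ S := fun h ↦ h.elim h0X h0Y
  -- it suffices to show `U ⊆ V`
  suffices hUV : U ⊆ V by
    have hVU : V ⊆ U := Loewner.unboundedComponent_subset U
    rw [show U = V from Subset.antisymm hUV hVU]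
    exact isConnected_unboundedComponent hSb
  intro z hzU
  by_contra hzV
  set P := connectedComponentIn U z with hPdef
  have hPb : IsBounded P := by
    by_contra hnb
    exact hzV ⟨hzU, hnb⟩
  have hPo : IsOpen P := hUo.connectedComponentIn
  have hPU : P ⊆ U := connectedComponentIn_subset U z
  -- `P ∩ V = ∅`
  have hPV : Disjoint P V := by
    refine Set.disjoint_left.2 fun w hwP hwV ↦ hwV.2 ?_
    rw [← connectedComponentIn_eq hwP]
    exact hPb
  -- frontier points of `P` are in `S` or real
  have hfrS : ∀ w ∈ frontier P, w ∈ upperHalfPlaneSet → w ∈ S := by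
    intro w hw hwH
    by_contra hwS
    exact notMem_of_mem_frontier_connectedComponentIn hUo hw ⟨hwH, hwS⟩
  -- frontier points off `X` and off `Y`
  obtain ⟨wY, hwYfr, hwYH, hwYX⟩ := exists_mem_frontier_diff (S := S) subset_union_left
    hXconn.isPreconnected (hfar X (subset_union_left.trans hR)) hzU hPb hSc
  obtain ⟨wX, hwXfr, hwXH, hwXY⟩ := exists_mem_frontier_diff (S := S) subset_union_right
    hYconn.isPreconnected (hfar Y (subset_union_right.trans hR)) hzU hPb hSc
  have hwYY : wY ∈ Y := ((hfrS wY hwYfr hwYH).resolve_left hwYX)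
  have hwXX : wX ∈ X := ((hfrS wX hwXfr hwXH).resolve_right hwXY)
  -- `closure P` misses `closure K = K ∪ {0}`
  have hclH : closure P ⊆ {w : ℂ | 0 ≤ w.im} := by
    have : P ⊆ {w : ℂ | 0 ≤ w.im} := fun w hw ↦ (show (0 : ℝ) < w.im from (hPU hw).1).le
    exact closure_minimal this (isClosed_le continuous_const Complex.continuous_im)
  have hclK : Disjoint (closure P) (closure (K : Set ℂ)) := by
    rw [K.closure_eq]
    refine Set.disjoint_left.2 fun w hwcl hwK ↦ ?_
    rcases hwK with hwK | hw0
    · -- `w ∈ K ⊆ V`: then `w ∉ P`, so `w ∈ frontier P ⊆ S ∪ ℝ`, impossible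
      have hwV : w ∈ V := hKV hwK
      have hwP : w ∉ P := fun h ↦ Set.disjoint_left.1 hPV h hwV
      have hwfr : w ∈ frontier P := by
        rw [frontier_eq_closure_inter_closure]; exact ⟨hwcl, subset_closure hwP⟩
      exact (hKU hwK).2 (hfrS w hwfr (K.subset_upperHalfPlaneSet hwK))
    · -- `w = 0`: a small half-ball at `0` lies in `V`, hence misses `P`
      rw [mem_singleton_iff] at hw0
      subst hw0
      obtain ⟨r, hr, hrS⟩ := Metric.isOpen_iff.1 hSc.isOpen_compl 0 h0S
      set B := ball (0 : ℂ) r ∩ upperHalfPlaneSet with hBdef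
      have hBU : B ⊆ U := fun w hw ↦ ⟨hw.2, fun hwS ↦ hrS hw.1 hwS⟩
      have hBconv : Convex ℝ B := (convex_ball _ _).inter (convex_halfSpace_im_gt 0)
      obtain ⟨k, hkB, hkK⟩ : ∃ k ∈ ball (0 : ℂ) r, k ∈ (K : Set ℂ) := by
        have := K.zero_mem_closure
        rw [Metric.mem_closure_iff] at this
        obtain ⟨k, hk, hkd⟩ := this r hr
        exact ⟨k, by rwa [mem_ball, dist_comm], hk⟩
      have hkB' : k ∈ B := ⟨hkB, K.subset_upperHalfPlaneSet hkK⟩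
      have hBV : B ⊆ V := by
        intro w hw
        have hwc : w ∈ connectedComponentIn U k :=
          hBconv.isPreconnected.subset_connectedComponentIn hkB' hBU hw
        refine ⟨hBU hw, fun hb ↦ (hKV hkK).2 ?_⟩
        rw [connectedComponentIn_eq hwc]
        exact hb
      rw [Metric.mem_closure_iff] at hwcl
      obtain ⟨p, hpP, hpd⟩ := hwcl r hr
      have hpB : p ∈ B := ⟨by rwa [mem_ball, dist_comm], (hPU hpP).1⟩
      exact Set.disjoint_left.1 hPV hpP (hBV hpB)
  have hclsub : closure P ⊆ {w : ℂ | 0 ≤ w.im} \ closure (K : Set ℂ) := fun w hw ↦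
    ⟨hclH hw, fun hwK ↦ Set.disjoint_left.1 hclK hw hwK⟩
  -- `closure P ⊆ rightDomain` (it meets `X` there), yet it meets `Y ⊆ leftDomain`
  have hclR : closure P ⊆ K.rightDomain :=
    K.subset_rightDomain_of_isPreconnected isPreconnected_connectedComponentIn.closure hclsub
      (frontier_subset_closure hwXfr) (hX hwXX)
  exact Set.disjoint_left.1 K.disjoint_rightDomain_leftDomain (hclR (frontier_subset_closure hwYfr))
    (hY hwYY)

end Summit.CriticalPhenomena.SAWScalingLimit.Theorems.AvoidanceDeterminesLaw

end
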